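import Literature.Probability.LatticeModels.PointwiseScalingLimitEtaExists
import HarnessLib

/-!
# Route `CoerciveSharpness`, crux `DimensionPinned` (item stmt-CriticalPhenomena-4662), line `Sketch`
# (octave telescoping on block variances): registered stub `stub_lowerEnvelope`

The lower envelope of the critical axis two-point function `g n = ⟨σ₀σ_{n e₀}⟩_{β_c(3)}` from the
growth of the block variances `V_L = Σ_{x,y ∈ [0,L)³} ⟨σ_xσ_y⟩_{β_c}` along `L = 2^k` and the upper
envelope: if `A (2^k)^{6-s} ≤ V_{2^k}` (`0 ≤ s ≤ 2`, `A > 0`) and `g n ≤ B n^{-s}` for `n ≥ 1`, then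
`g n ≥ c n^{-s}` for `n ≥ 1`.  Mechanism (shell peeling): `V_L ≤ L³ Σ_{‖z‖∞ ≤ L} G z`, the sum over
`‖z‖∞ ≤ P` is `≤ 1 + 54 B P^{3-s}` by the upper envelope and the Messager–Miracle-Solé bound
`G z ≤ g(‖z‖∞)` (shell count `sum_box_erase_norm_rpow_le`), the sum over `P < ‖z‖∞ ≤ L` is
`≤ (2L+1)³ g(P+1)`; with `L = 2^j P`, `2^j ≍ B/A`, this forces `g(P+1) ≥ (A/54) L^{-s}`.
Helper file (`--supports`); the composition lives in the lead's skeleton `Cruxes/DimensionPinned/Lines/Sketch.lean`.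
No definition, no notation.
-/

noncomputable section

namespace Summit.CriticalPhenomena.Ising3DConformalLimit.Theorems.CoerciveSharpnessDimensionPinned

open scoped BigOperators
open Finset
open Literature.Probability.LatticeModels

/-- `|[0,M)³ ∩ ℤ³| = M³`. [folklore] -/
theorem card_cube (M : ℕ) :
    #(Fintype.piFinset (fun _ : Fin 3 => Finset.Ico (0:ℤ) (M:ℤ))) = M ^ 3 := by
  rw [Fintype.card_piFinset, Finset.prod_const, Int.card_Ico]
  simp

/-- The difference of two points of the cube `[0,M)³` lies in the centred box `Λ_M`. [folklore] -/
theorem sub_mem_box_of_mem_cube {M : ℕ} {x y : Site 3}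
    (hx : x ∈ Fintype.piFinset (fun _ : Fin 3 => Finset.Ico (0:ℤ) (M:ℤ)))
    (hy : y ∈ Fintype.piFinset (fun _ : Fin 3 => Finset.Ico (0:ℤ) (M:ℤ))) :
    y - x ∈ box 3 M := by
  rw [Fintype.mem_piFinset] at hx hy
  rw [mem_box]
  intro i
  have h1 := Finset.mem_Ico.1 (hx i)
  have h2 := Finset.mem_Ico.1 (hy i)
  simp only [Pi.sub_apply]
  constructor <;> omega

/-- **Block variance versus box sum**: `V_M ≤ M³ · Σ_{‖z‖∞ ≤ M} ⟨σ₀σ_z⟩_{β_c}` (for each `x` the map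
`y ↦ y - x` is injective into `Λ_M`, and the summands are nonnegative). [folklore] -/
theorem cube_sum_le_box_sum (M : ℕ) :
    (∑ x ∈ Fintype.piFinset (fun _ : Fin 3 => Finset.Ico (0:ℤ) (M:ℤ)),
        ∑ y ∈ Fintype.piFinset (fun _ : Fin 3 => Finset.Ico (0:ℤ) (M:ℤ)), criticalTwoPoint 3 (y - x)) ≤
      (M : ℝ) ^ 3 * ∑ z ∈ box 3 M, criticalTwoPoint 3 z := by
  set Q := Fintype.piFinset (fun _ : Fin 3 => Finset.Ico (0:ℤ) (M:ℤ)) with hQ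
  have hinner : ∀ x ∈ Q, ∑ y ∈ Q, criticalTwoPoint 3 (y - x) ≤ ∑ z ∈ box 3 M, criticalTwoPoint 3 z := by
    intro x hx
    have hinj : Set.InjOn (fun y : Site 3 => y - x) Q := fun a _ b _ h => sub_left_injective h
    rw [← Finset.sum_image (f := fun z => criticalTwoPoint 3 z) hinj]
    refine Finset.sum_le_sum_of_subset_of_nonneg ?_ fun z _ _ => criticalTwoPoint_nonneg' z
    intro z hz
    obtain ⟨y, hy, rfl⟩ := Finset.mem_image.1 hz
    exact sub_mem_box_of_mem_cube hx hy
  calc ∑ x ∈ Q, ∑ y ∈ Q, criticalTwoPoint 3 (y - x)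
      ≤ ∑ _x ∈ Q, ∑ z ∈ box 3 M, criticalTwoPoint 3 z := Finset.sum_le_sum hinner
    _ = (M : ℝ) ^ 3 * ∑ z ∈ box 3 M, criticalTwoPoint 3 z := by
        rw [Finset.sum_const, card_cube, nsmul_eq_mul]
        push_cast
        ring

/-- **Shell peeling**: for `P ≤ L`,
`Σ_{‖z‖∞ ≤ L} G z ≤ Σ_{‖z‖∞ ≤ P} G z + (2L+1)³ · ⟨σ₀σ_{(P+1)e₀}⟩_{β_c}` (Messager–Miracle-Solé:
`G z ≤ ⟨σ₀σ_{‖z‖∞ e₀}⟩`, antitone along the axis). [cite: MessagerMiracleSoleJSP1977, main theorem] -/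
theorem box_sum_split {P L : ℕ} (hPL : P ≤ L) :
    ∑ z ∈ box 3 L, criticalTwoPoint 3 z ≤
      (∑ z ∈ box 3 P, criticalTwoPoint 3 z) +
        (((2 * L + 1 : ℕ)) : ℝ) ^ 3 * criticalTwoPoint 3 (Pi.single 0 ((P + 1 : ℕ) : ℤ)) := by
  have hsub : box 3 P ⊆ box 3 L := box_mono 3 hPL
  rw [← Finset.sum_sdiff hsub, add_comm]
  gcongr
  have hterm : ∀ z ∈ box 3 L \ box 3 P,
      criticalTwoPoint 3 z ≤ criticalTwoPoint 3 (Pi.single 0 ((P + 1 : ℕ) : ℤ)) := by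
    intro z hz
    rw [Finset.mem_sdiff, mem_box_iff_supNorm_le, mem_box_iff_supNorm_le] at hz
    have hn : P + 1 ≤ Site.supNorm z := by omega
    have h1 : 1 ≤ Site.supNorm z := by omega
    calc criticalTwoPoint 3 z ≤ criticalTwoPoint 3 (Pi.single 0 (Site.supNorm z : ℤ)) :=
          (criticalTwoPoint_axis_sandwich h1).2
      _ ≤ criticalTwoPoint 3 (Pi.single 0 ((P + 1 : ℕ) : ℤ)) := criticalTwoPoint_axis_antitone hn
  calc ∑ z ∈ box 3 L \ box 3 P, criticalTwoPoint 3 z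
      ≤ ∑ _z ∈ box 3 L \ box 3 P, criticalTwoPoint 3 (Pi.single 0 ((P + 1 : ℕ) : ℤ)) :=
        Finset.sum_le_sum hterm
    _ = (#(box 3 L \ box 3 P) : ℝ) * criticalTwoPoint 3 (Pi.single 0 ((P + 1 : ℕ) : ℤ)) := by
        rw [Finset.sum_const, nsmul_eq_mul]
    _ ≤ (((2 * L + 1 : ℕ)) : ℝ) ^ 3 * criticalTwoPoint 3 (Pi.single 0 ((P + 1 : ℕ) : ℤ)) := by
        refine mul_le_mul_of_nonneg_right ?_ (criticalTwoPoint_nonneg' _)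
        have h := Finset.card_le_card (Finset.sdiff_subset (s := box 3 L) (t := box 3 P))
        rw [card_box] at h
        exact_mod_cast h

/-- **The truncated susceptibility under the upper envelope**: if `⟨σ₀σ_{ne₀}⟩ ≤ B n^{-s}` (`n ≥ 1`)
with `0 ≤ s ≤ 2`, then `Σ_{‖z‖∞ ≤ P} G z ≤ 1 + 54 B P^{3-s}` for `P ≥ 1` (MMS `G z ≤ ⟨σ₀σ_{‖z‖∞e₀}⟩`,
shell count `sum_box_erase_norm_rpow_le`). [cite: MessagerMiracleSoleJSP1977, main theorem] -/
theorem box_sum_le_of_upper {s B : ℝ} (hs2 : s ≤ 2)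
    (hup : ∀ n : ℕ, 1 ≤ n → criticalTwoPoint 3 (Pi.single 0 (n : ℤ)) ≤ B * (n : ℝ) ^ (-s))
    {P : ℕ} (hP : 1 ≤ P) :
    ∑ z ∈ box 3 P, criticalTwoPoint 3 z ≤ 1 + 54 * B * (P : ℝ) ^ ((3:ℝ) - s) := by
  have hB : 0 ≤ B := by
    have h := (criticalTwoPoint_axis_pos 1).trans_le (hup 1 le_rfl)
    simp at h
    exact h.le
  have hPpos : (0:ℝ) < P := by exact_mod_cast (show 0 < P by omega)
  rw [← Finset.add_sum_erase _ _ (zero_mem_box 3 P), criticalTwoPoint_zero']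
  gcongr
  -- termwise: `G z ≤ B ‖z‖^{-s}` off the origin
  have hterm : ∀ z ∈ (box 3 P).erase 0, criticalTwoPoint 3 z ≤ B * ‖z‖ ^ (-s) := by
    intro z hz
    have hz0 : z ≠ 0 := Finset.ne_of_mem_erase hz
    have h1 : 1 ≤ Site.supNorm z :=
      Nat.one_le_iff_ne_zero.2 fun h0 => hz0 (Site.supNorm_eq_zero_iff.1 h0)
    calc criticalTwoPoint 3 z ≤ criticalTwoPoint 3 (Pi.single 0 (Site.supNorm z : ℤ)) :=
          (criticalTwoPoint_axis_sandwich h1).2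
      _ ≤ B * ((Site.supNorm z : ℕ) : ℝ) ^ (-s) := hup _ h1
      _ = B * ‖z‖ ^ (-s) := by rw [Site.norm_eq_supNorm]
  have hshell := sum_box_erase_norm_rpow_le s P
  have hpow : ∀ m ∈ Finset.range P, ((m : ℝ) + 1) ^ (2 - s) ≤ (P : ℝ) ^ (2 - s) := by
    intro m hm
    have hm' : (m : ℝ) + 1 ≤ P := by exact_mod_cast Finset.mem_range.1 hm
    exact Real.rpow_le_rpow (by positivity) hm' (by linarith)
  have hsum : ∑ m ∈ Finset.range P, ((m : ℝ) + 1) ^ (2 - s) ≤ (P : ℝ) * (P : ℝ) ^ (2 - s) := by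
    calc ∑ m ∈ Finset.range P, ((m : ℝ) + 1) ^ (2 - s) ≤ ∑ _m ∈ Finset.range P, (P : ℝ) ^ (2 - s) :=
          Finset.sum_le_sum hpow
      _ = (P : ℝ) * (P : ℝ) ^ (2 - s) := by rw [Finset.sum_const, Finset.card_range, nsmul_eq_mul]
  have hP3 : (P : ℝ) * (P : ℝ) ^ (2 - s) = (P : ℝ) ^ ((3:ℝ) - s) := by
    rw [show (3:ℝ) - s = 1 + (2 - s) by ring, Real.rpow_add hPpos, Real.rpow_one]
  calc ∑ z ∈ (box 3 P).erase 0, criticalTwoPoint 3 z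
      ≤ ∑ z ∈ (box 3 P).erase 0, B * ‖z‖ ^ (-s) := Finset.sum_le_sum hterm
    _ = B * ∑ z ∈ (box 3 P).erase 0, ‖z‖ ^ (-s) := by rw [Finset.mul_sum]
    _ ≤ B * (54 * ((P : ℝ) * (P : ℝ) ^ (2 - s))) :=
        mul_le_mul_of_nonneg_left (hshell.trans (by linarith)) hB
    _ = 54 * B * (P : ℝ) ^ ((3:ℝ) - s) := by rw [hP3]; ring

/-- **Registered stub `stub_lowerEnvelope` of line `Sketch`, proved.** If the block variances of
the critical two-point function over the cubes `[0,2^k)³` satisfy `A (2^k)^{6-s} ≤ V_{2^k}` with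
`0 ≤ s ≤ 2`, `A > 0`, and the axis two-point function has the upper envelope `B n^{-s}`, then it has
a lower envelope `c n^{-s}`, `c > 0` (shell peeling with the Messager–Miracle-Solé bound).
[cite: MessagerMiracleSoleJSP1977, main theorem] -/
theorem stub_lowerEnvelope :
    ∀ (s A B : ℝ), 0 ≤ s → s ≤ 2 → 0 < A →
      (∀ k : ℕ, A * ((2:ℝ) ^ k) ^ ((6:ℝ) - s) ≤
        ∑ x ∈ Fintype.piFinset (fun _ : Fin 3 => Finset.Ico (0:ℤ) (2 ^ k)),
          ∑ y ∈ Fintype.piFinset (fun _ : Fin 3 => Finset.Ico (0:ℤ) (2 ^ k)), criticalTwoPoint 3 (y - x)) →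
      (∀ n : ℕ, 1 ≤ n → criticalTwoPoint 3 (Pi.single 0 (n : ℤ)) ≤ B * (n : ℝ) ^ (-s)) →
      ∃ c : ℝ, 0 < c ∧ ∀ n : ℕ, 1 ≤ n → c * (n : ℝ) ^ (-s) ≤ criticalTwoPoint 3 (Pi.single 0 (n : ℤ)) := by
  intro s A B hs0 hs2 hA hV hup
  have hB : 0 ≤ B := by
    have h := (criticalTwoPoint_axis_pos 1).trans_le (hup 1 le_rfl)
    simp at h
    exact h.le
  -- choose `j` with `2^j ≥ 216 B / A` and `2^j ≥ 4 / A`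
  obtain ⟨j, hj⟩ : ∃ j : ℕ, max (216 * B / A) (4 / A) ≤ (2:ℝ) ^ j := by
    obtain ⟨j, hj⟩ := pow_unbounded_of_one_lt (max (216 * B / A) (4 / A)) one_lt_two
    exact ⟨j, hj.le⟩
  have hj1 : 216 * B / A ≤ (2:ℝ) ^ j := (le_max_left _ _).trans hj
  have hj2 : 4 / A ≤ (2:ℝ) ^ j := (le_max_right _ _).trans hj
  refine ⟨A / 54 * ((2:ℝ) ^ (j + 1)) ^ (-s), by positivity, fun n hn => ?_⟩
  -- scales: `P = 2^(t+1) > n`, `L = 2^j P = 2^K`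
  set t := Nat.log 2 n with ht
  have htn : n < 2 ^ (t + 1) := Nat.lt_pow_succ_log_self (by norm_num) n
  have htn' : 2 ^ t ≤ n := Nat.pow_log_le_self 2 (by omega)
  set K := t + 1 + j with hK
  have hPL : 2 ^ (t + 1) ≤ 2 ^ K := Nat.pow_le_pow_right (by norm_num) (by omega)
  -- real versions
  have hnpos : (0:ℝ) < n := by exact_mod_cast (show 0 < n by omega)
  set P : ℝ := (2:ℝ) ^ (t + 1) with hP
  set L : ℝ := (2:ℝ) ^ K with hL
  have hPpos : 0 < P := by positivity
  have hLpos : 0 < L := by positivity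
  have hLP : L = (2:ℝ) ^ j * P := by simp only [hL, hP, hK]; ring
  have hL1 : 1 ≤ L := one_le_pow₀ (by norm_num)
  -- (1) the variance bound at scale `2^K`, moved to the box sum
  have h1 : A * L ^ ((6:ℝ) - s) ≤ L ^ 3 * ∑ z ∈ box 3 (2 ^ K), criticalTwoPoint 3 z := by
    have hv := hV K
    have hc := cube_sum_le_box_sum (2 ^ K)
    push_cast at hc
    exact hv.trans hc
  -- (2) shell peeling at `P = 2^(t+1) ≤ 2^K`
  have h2 := box_sum_split (P := 2 ^ (t + 1)) (L := 2 ^ K) hPL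
  -- (3) the inner box under the upper envelope
  have h3 := box_sum_le_of_upper hs2 hup (P := 2 ^ (t + 1)) Nat.one_le_two_pow
  push_cast at h2 h3
  -- bookkeeping: `(2·2^K+1)^3 ≤ 27 L^3`
  have h27 : ((2:ℝ) * (2:ℝ) ^ K + 1) ^ 3 ≤ 27 * L ^ 3 := by
    have : (2:ℝ) * (2:ℝ) ^ K + 1 ≤ 3 * L := by simp only [hL]; linarith
    calc ((2:ℝ) * (2:ℝ) ^ K + 1) ^ 3 ≤ (3 * L) ^ 3 := by
          exact pow_le_pow_left₀ (by positivity) this 3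
      _ = 27 * L ^ 3 := by ring
  set gP := criticalTwoPoint 3 (Pi.single 0 (((2 ^ (t + 1) + 1 : ℕ)) : ℤ)) with hgP
  have hgP0 : 0 ≤ gP := criticalTwoPoint_nonneg' _
  -- combine (1)–(3): `A L^{6-s} ≤ L^3 (1 + 54 B P^{3-s} + 27 L^3 gP)`
  have hcomb : A * L ^ ((6:ℝ) - s) ≤ L ^ 3 * (1 + 54 * B * P ^ ((3:ℝ) - s) + 27 * L ^ 3 * gP) := by
    have hstep : ∑ z ∈ box 3 (2 ^ K), criticalTwoPoint 3 z ≤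
        1 + 54 * B * P ^ ((3:ℝ) - s) + 27 * L ^ 3 * gP := by
      calc ∑ z ∈ box 3 (2 ^ K), criticalTwoPoint 3 z
          ≤ (∑ z ∈ box 3 (2 ^ (t + 1)), criticalTwoPoint 3 z) + ((2:ℝ) * (2:ℝ) ^ K + 1) ^ 3 * gP := h2
        _ ≤ (1 + 54 * B * P ^ ((3:ℝ) - s)) + 27 * L ^ 3 * gP :=
            add_le_add h3 (mul_le_mul_of_nonneg_right h27 hgP0)
    calc A * L ^ ((6:ℝ) - s) ≤ L ^ 3 * ∑ z ∈ box 3 (2 ^ K), criticalTwoPoint 3 z := h1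
      _ ≤ L ^ 3 * (1 + 54 * B * P ^ ((3:ℝ) - s) + 27 * L ^ 3 * gP) :=
          mul_le_mul_of_nonneg_left hstep (by positivity)
  -- exponent algebra: `L^{6-s} = L^3 · L^{3-s}`, `L^{3-s} ≥ 2^j P^{3-s}`, `L^{3-s} ≥ L`
  have hL6 : L ^ ((6:ℝ) - s) = L ^ 3 * L ^ ((3:ℝ) - s) := by
    rw [show (6:ℝ) - s = 3 + ((3:ℝ) - s) by ring, Real.rpow_add hLpos,
      show L ^ (3:ℝ) = L ^ (3:ℕ) from by exact_mod_cast Real.rpow_natCast L 3]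
  have hmain : A * L ^ ((3:ℝ) - s) ≤ 1 + 54 * B * P ^ ((3:ℝ) - s) + 27 * L ^ 3 * gP := by
    rw [hL6, ← mul_assoc, mul_comm A, mul_assoc] at hcomb
    exact le_of_mul_le_mul_left hcomb (by positivity)
  have hL3s_ge_L : L ≤ L ^ ((3:ℝ) - s) := by
    have := Real.rpow_le_rpow_of_exponent_le hL1 (show (1:ℝ) ≤ 3 - s by linarith)
    rwa [Real.rpow_one] at this
  have hL3s : (2:ℝ) ^ j * P ^ ((3:ℝ) - s) ≤ L ^ ((3:ℝ) - s) := by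
    rw [hLP, Real.mul_rpow (by positivity) hPpos.le]
    refine mul_le_mul_of_nonneg_right ?_ (by positivity)
    have := Real.rpow_le_rpow_of_exponent_le (one_le_pow₀ (by norm_num : (1:ℝ) ≤ 2) (n := j))
      (show (1:ℝ) ≤ 3 - s by linarith)
    rwa [Real.rpow_one] at this
  -- the two small terms are each `≤ (A/4) L^{3-s}`
  have hsmall1 : (1:ℝ) ≤ A / 4 * L ^ ((3:ℝ) - s) := by
    have h4 : 4 / A ≤ L := hj2.trans (by
      rw [hLP]
      have : (1:ℝ) ≤ P := one_le_pow₀ (by norm_num)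
      nlinarith [pow_pos (two_pos (α := ℝ)) j])
    have h4' : 4 ≤ A * L := by rw [div_le_iff₀ hA] at h4; linarith
    nlinarith [hL3s_ge_L, hA]
  have hsmall2 : 54 * B * P ^ ((3:ℝ) - s) ≤ A / 4 * L ^ ((3:ℝ) - s) := by
    have hP3 : 0 ≤ P ^ ((3:ℝ) - s) := by positivity
    have h216 : 216 * B ≤ A * (2:ℝ) ^ j := by rw [div_le_iff₀ hA] at hj1; linarith
    calc 54 * B * P ^ ((3:ℝ) - s) = (216 * B) / 4 * P ^ ((3:ℝ) - s) := by ring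
      _ ≤ (A * (2:ℝ) ^ j) / 4 * P ^ ((3:ℝ) - s) := by gcongr
      _ = A / 4 * ((2:ℝ) ^ j * P ^ ((3:ℝ) - s)) := by ring
      _ ≤ A / 4 * L ^ ((3:ℝ) - s) := mul_le_mul_of_nonneg_left hL3s (by positivity)
  -- hence `27 L^3 gP ≥ (A/2) L^{3-s}`, i.e. `gP ≥ (A/54) L^{-s}`
  have hgP : A / 54 * L ^ (-s) ≤ gP := by
    have hkey : A / 2 * L ^ ((3:ℝ) - s) ≤ 27 * L ^ 3 * gP := by linarith
    have hL3s' : L ^ ((3:ℝ) - s) = L ^ 3 * L ^ (-s) := by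
      rw [show (3:ℝ) - s = 3 + (-s) by ring, Real.rpow_add hLpos,
        show L ^ (3:ℝ) = L ^ (3:ℕ) from by exact_mod_cast Real.rpow_natCast L 3]
    rw [hL3s'] at hkey
    have hL3pos : 0 < L ^ 3 := by positivity
    have : L ^ 3 * (A / 54 * L ^ (-s)) ≤ L ^ 3 * gP := by nlinarith
    exact le_of_mul_le_mul_left this hL3pos
  -- transport to `n`: `n < P + 1` (antitone) and `L^{-s} ≥ (2^{j+1})^{-s} n^{-s}` (`L ≤ 2^{j+1} n`)
  have hmono : gP ≤ criticalTwoPoint 3 (Pi.single 0 (n : ℤ)) :=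
    criticalTwoPoint_axis_antitone (show n ≤ 2 ^ (t + 1) + 1 by omega)
  have hLn : L ≤ (2:ℝ) ^ (j + 1) * n := by
    have h2t : (2:ℝ) ^ t ≤ n := by exact_mod_cast htn'
    have : L = (2:ℝ) ^ (j + 1) * (2:ℝ) ^ t := by simp only [hL, hK]; ring
    rw [this]
    exact mul_le_mul_of_nonneg_left h2t (by positivity)
  have hpow : ((2:ℝ) ^ (j + 1)) ^ (-s) * (n:ℝ) ^ (-s) ≤ L ^ (-s) := by
    rw [← Real.mul_rpow (by positivity) hnpos.le]
    exact Real.rpow_le_rpow_of_nonpos hLpos hLn (neg_nonpos.2 hs0)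
  calc A / 54 * ((2:ℝ) ^ (j + 1)) ^ (-s) * (n:ℝ) ^ (-s)
      = A / 54 * (((2:ℝ) ^ (j + 1)) ^ (-s) * (n:ℝ) ^ (-s)) := by ring
    _ ≤ A / 54 * L ^ (-s) := mul_le_mul_of_nonneg_left hpow (by positivity)
    _ ≤ gP := hgP
    _ ≤ criticalTwoPoint 3 (Pi.single 0 (n : ℤ)) := hmono

end Summit.CriticalPhenomena.Ising3DConformalLimit.Theorems.CoerciveSharpnessDimensionPinned
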